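import Summits.QuantumFields.YangMills.Theorems.UnitScaleTiltProp8FibreTangentCurve
import Summits.QuantumFields.YangMills.Theorems.UnitScaleTiltMinimiserStabilityRegPrAvgCurvGrad
import Literature.MathematicalPhysics.QuantumFieldTheory.Balaban1983to89.BlockAveragingExpMeanLogContinuous
import Literature.MathematicalPhysics.QuantumFieldTheory.Balaban1983to89.T3OneStepAveragingPlaquettes
import HarnessLib

/-!
# Route `UnitScaleTilt`, crux K1 «MinimiserStabilityRegPr» (stmt-QuantumFields-19200), stub `stub_prop8` (V2) — sub-lemma V2-EL, part 6: **THE EULER–LAGRANGE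
# EQUATION OF R2-CRITICAL CONFIGURATIONS AT THE d = 3 CARRIER, MULTIPLIER FORM** (`exists_tangent_lin_eq_zero_of_isCritR2`): for `U₀` R2-critical over a
# datum `V` (`T3Thm1CarrierNative.IsCritR2`: minimiser of the Wilson action over print's regular fibre `(6)(e)` of run `K + 1` over height `n ≤ K`) with
# `t₀`-small plaquettes, `stokesConst·t₀ ≤ |I|⁻¹/1000`, every non-central fine bond `b₀` and every differentiable `SU(2)`-curve through `U₀(b₀)` with velocity
# `D₀`: `∃ ξ, ξ(b₀) = D₀U₀(b₀)^* ∧ (ξ = 0 off {b₀} ∪ centralBond) ∧ Lin_{U₀}(ξ) = 0`.  Ingredients: nested criticality (part 2, `isCritR2_oneStepSlice`),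
# the OPENNESS OF 𝔘_k(e) IN THE BONDS (§2 here: both clauses of [Balaban1985Variational] (2) are strict inequalities of continuous functions of the
# configuration — §1 proves the continuity of transports, plaquettes and of the covariant divergence [Balaban1985RegularSpaces] (1.1)–(1.2) in `M₂(ℂ)`),
# the identification of the one-step descent fibre with `{Ū = Ū₀}` (`T3OneStepAveragingPlaquettes.descendTo_succ`), and the one-step theorem of part 5b.

Cell `ym3-torus` ∕ fleet seat `ym-ust-19200-p2` g3.  This closes the lattice-level criticality structure (EL) of the V2 census for the TOP averaging step:
[Balaban1985Variational] p. 300 «We will use only the fact that they are critical configurations of the functional (5)» is now available at the carrier as a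
theorem about `IsCritR2` configurations, with k-free hypotheses and no chart ∕ Green's function.  What it does NOT give: the k-uniform QUANTITATIVE bound on the
multipliers (elliptic; pillar D3 of the census), nor variations of the lower averaging steps (they factor through the one-step structure at each level).
WHAT IS PROVED (sorry-free, no definition; [folklore] ∕ cited): §1 `continuous_coe_apply(_inv)`, **`continuous_coe_holAt`**, **`continuous_covDivT`**,
`continuous_coe_plaqHol`; §2 **`exists_ball_subset_regPr`**; §3 **`exists_tangent_lin_eq_zero_of_isCritR2`**.
References: T. Bałaban, CMP 102 (1985) 277–309 [Balaban1985Variational] ((2) p.278, (127) p.297, p.300, Prop. 8 p.304); CMP 99 (1985) 75–102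
[Balaban1985RegularSpaces] ((1.1)–(1.2) p.76); CMP 109 (1987) 249–301 [Balaban1987RG1] ((0.4), (0.11) p.253).
-/

noncomputable section

open scoped BigOperators Matrix.Norms.L2Operator Matrix Topology
open Filter Function

namespace Summit.QuantumFields.YangMills.Theorems.Prop8Criticality

open Literature.MathematicalPhysics.QuantumFieldTheory.Balaban1983to89
open T4Continuum AveragingRT BlockAveraging BlockAveragingHaarAC ExpMeanLog
open B10Eq27TorusAxialLog (toUField unitsField holT_eq_holAt)
open B10Eq68TorusRegularity (plaqFT covDerivT covDivT)
open B7Eq78Linearization (conjR conjR_apply)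
open Summit.QuantumFields.YangMills.Theorems.AvgCurvGrad (plaqFT_toUField val_unitsField_toUField val_unitsField_toUField_inv)

variable {P : Params} {j : ℕ}

/-! ## §1 Continuity of transports and of the covariant divergence in the configuration -/

section Continuity

/-- Bond variables read in `M₂(ℂ)` are continuous in the configuration (product topology). [folklore] -/
theorem continuous_coe_apply (b : PBond P j) :
    Continuous fun U : GaugeField P j (Matrix.specialUnitaryGroup (Fin 2) ℂ) => ((U b : Matrix.specialUnitaryGroup (Fin 2) ℂ) : Matrix (Fin 2) (Fin 2) ℂ) :=
  continuous_subtype_val.comp (continuous_apply b)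

/-- … and so are their inverses. [folklore] -/
theorem continuous_coe_apply_inv (b : PBond P j) :
    Continuous fun U : GaugeField P j (Matrix.specialUnitaryGroup (Fin 2) ℂ) => (((U b)⁻¹ : Matrix.specialUnitaryGroup (Fin 2) ℂ) : Matrix (Fin 2) (Fin 2) ℂ) :=
  continuous_subtype_val.comp ((continuous_apply b).inv)

/-- **PARALLEL TRANSPORTS ARE CONTINUOUS IN THE CONFIGURATION** (read in `M₂(ℂ)`). [folklore] -/
theorem continuous_coe_holAt :
    ∀ γ : List (LStep P j), Continuous fun U : GaugeField P j (Matrix.specialUnitaryGroup (Fin 2) ℂ) =>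
      ((holAt U γ : Matrix.specialUnitaryGroup (Fin 2) ℂ) : Matrix (Fin 2) (Fin 2) ℂ)
  | [] => by simp only [holAt_nil]; exact continuous_const
  | s :: γ => by
    simp only [holAt_cons, Submonoid.coe_mul]
    refine Continuous.mul ?_ (continuous_coe_holAt γ)
    cases hs : s.fwd
    · simp only [Bool.false_eq_true, ↓reduceIte]; exact continuous_coe_apply_inv s.bond
    · simp only [↓reduceIte]; exact continuous_coe_apply s.bond

/-- **THE COVARIANT DIVERGENCE OF THE PLAQUETTE FIELD IS CONTINUOUS IN THE CONFIGURATION** ([Balaban1985RegularSpaces] (1.1)–(1.2) for `SU(2)` fields,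
read in `M₂(ℂ)`: finite sums of transports). [cite: Balaban1985RegularSpaces, (1.1)-(1.2) p.76] -/
theorem continuous_covDivT (μ : Fin P.d) (x : Site P j) :
    Continuous fun U : GaugeField P j (Matrix.specialUnitaryGroup (Fin 2) ℂ) => covDivT 1 (unitsField (toUField U)) μ x := by
  unfold covDivT covDerivT
  simp only [conjR_apply, inv_inv, plaqFT_toUField, val_unitsField_toUField_inv, val_unitsField_toUField, inv_one, one_smul, holT_eq_holAt]
  refine Continuous.sub (continuous_finsetSum _ fun ν _ => ?_) (continuous_finsetSum _ fun ν _ => ?_) <;>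
    exact (((continuous_coe_apply_inv _).mul (continuous_coe_holAt _)).mul (continuous_coe_apply _)).sub (continuous_coe_holAt _)

/-- Plaquette variables read in `M₂(ℂ)` are continuous in the configuration. [folklore] -/
theorem continuous_coe_plaqHol (p : Plaq P j) :
    Continuous fun U : GaugeField P j (Matrix.specialUnitaryGroup (Fin 2) ℂ) =>
      ((GaugeField.plaqHol U p : Matrix.specialUnitaryGroup (Fin 2) ℂ) : Matrix (Fin 2) (Fin 2) ℂ) := by
  unfold GaugeField.plaqHol
  simp only [Submonoid.coe_mul]
  exact (((continuous_coe_apply _).mul (continuous_coe_apply _)).mul (continuous_coe_apply_inv _)).mul (continuous_coe_apply_inv _)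

end Continuity

/-! ## §2 Print's regular space (2) is open in the bond variables -/

section Open

open T3ContinuumYM3Torus T3PrintedRegularMinimiser T3RegularMinimiser

/-- **𝔘_k(e) IS OPEN IN THE BONDS** at the d = 3 carrier: if `U₀ ∈ 𝔘_k(e)` (`RegPr`: strict plaquette and covariant-divergence clauses of [Balaban1985Variational] (2)),
then every configuration bondwise within some `δ > 0` of `U₀` lies in `𝔘_k(e)` (finitely many strict inequalities of continuous functions). [cite: Balaban1985Variational, (2) p.278] -/
theorem exists_ball_subset_regPr (F : T3Family) (n K : ℕ) (e : ℝ) (U₀ : GaugeField (F.P K) 0 (Matrix.specialUnitaryGroup (Fin 2) ℂ))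
    (h : RegPr F n K e U₀) :
    ∃ δ : ℝ, 0 < δ ∧ ∀ U : GaugeField (F.P K) 0 (Matrix.specialUnitaryGroup (Fin 2) ℂ),
      (∀ b, ‖((U b : Matrix.specialUnitaryGroup (Fin 2) ℂ) : Matrix (Fin 2) (Fin 2) ℂ) - (U₀ b : Matrix (Fin 2) (Fin 2) ℂ)‖ < δ) → RegPr F n K e U := by
  classical
  -- the regular space as a finite intersection of strict sublevel sets of continuous functions
  set O : Set (GaugeField (F.P K) 0 (Matrix.specialUnitaryGroup (Fin 2) ℂ)) := {U | RegPr F n K e U} with hO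
  have hOeq : O = (⋂ p : Plaq (F.P K) 0, {U | ‖((GaugeField.plaqHol U p : Matrix.specialUnitaryGroup (Fin 2) ℂ) : Matrix (Fin 2) (Fin 2) ℂ) - 1‖
        < regThreshold F n K e}) ∩
      ⋂ b : PBond (F.P K) 0, {U | ‖covDivT 1 (unitsField (toUField U)) b.dir b.src‖ < e * ((F.L : ℝ)⁻¹) ^ (3 * (K - n))} := by
    ext U
    simp only [hO, Set.mem_setOf_eq, Set.mem_inter_iff, Set.mem_iInter, RegPr, PlaqSmall, DivSmall, SU2Mean.dist1_eq_norm]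
  have hOopen : IsOpen O := by
    rw [hOeq]
    refine (isOpen_iInter_of_finite fun p => isOpen_lt ((continuous_coe_plaqHol p).sub continuous_const).norm continuous_const).inter
      (isOpen_iInter_of_finite fun b => isOpen_lt (continuous_covDivT b.dir b.src).norm continuous_const)
  have hU₀ : U₀ ∈ O := h
  -- a product neighbourhood inside `O`
  obtain ⟨I, u, hu, hsub⟩ := isOpen_pi_iff.mp hOopen U₀ hU₀
  have hε : ∀ a : PBond (F.P K) 0, ∃ ε : ℝ, 0 < ε ∧ (a ∈ I → Metric.ball (U₀ a) ε ⊆ u a) := by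
    intro a
    by_cases ha : a ∈ I
    · obtain ⟨ε, hε, hball⟩ := Metric.isOpen_iff.mp (hu a ha).1 (U₀ a) (hu a ha).2
      exact ⟨ε, hε, fun _ => hball⟩
    · exact ⟨1, one_pos, fun h' => absurd h' ha⟩
  choose ε hεpos hεball using hε
  set δ : ℝ := (insert (1 : ℝ) (Finset.univ.image ε)).min' (Finset.insert_nonempty _ _) with hδ
  have hδpos : 0 < δ := by
    rw [hδ, Finset.lt_min'_iff]
    intro y hy
    rcases Finset.mem_insert.mp hy with rfl | hy
    · exact one_pos
    · obtain ⟨a, -, rfl⟩ := Finset.mem_image.mp hy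
      exact hεpos a
  have hδle : ∀ a, δ ≤ ε a := fun a =>
    Finset.min'_le _ _ (Finset.mem_insert_of_mem (Finset.mem_image.mpr ⟨a, Finset.mem_univ _, rfl⟩))
  refine ⟨δ, hδpos, fun U hUδ => ?_⟩
  have hmem : U ∈ O := by
    refine hsub fun a ha => hεball a ha ?_
    rw [Metric.mem_ball, Subtype.dist_eq, dist_eq_norm]
    exact (hUδ a).trans_le (hδle a)
  exact hmem

end Open

/-! ## §3 The one-step Euler–Lagrange equation for R2-critical configurations of the d = 3 carrier -/

section Carrier

open T3ContinuumYM3Torus T3UnitLawDensityEML T3ConstrainedMinimiser T3TiltDescent T3DescentFibreTower T3OneStepAveragingPlaquettes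
open T3PrintedRegularMinimiser T3RegularMinimiser T3Thm1CarrierNative
open Summit.QuantumFields.YangMills.Theorems.BlockAvgCorrector (stokesConst)
open BlockAveragingEMLHaarAC (emlWeight)

/-- **THE EULER–LAGRANGE EQUATION OF AN R2-CRITICAL CONFIGURATION AT THE d = 3 CARRIER, MULTIPLIER FORM.**  Let `U₀` be R2-critical over the datum `V`
([Balaban1985Variational] «critical configuration of (5) in (6)» in `T3Thm1Carrier`'s reading: a minimiser of the Wilson action over print's regular fibre
`(6)(e) = 𝔘_k(e) ∩ 𝔅_k(V)` of run `K + 1` over the comparison height `n ≤ K`, for some `e > 0`), with plaquettes `t₀`-small, `stokesConst·t₀ ≤ |I|⁻¹/1000`.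
Then for every bond `b₀` of the finest lattice that is not a central crossing bond of the top (0.4)-averaging step and every differentiable `SU(2)`-curve `g`
through `U₀(b₀)` with velocity `D₀` there is a bond field `ξ` with `ξ(b₀) = D₀U₀(b₀)^*`, `ξ = 0` at every other non-central bond, and `Lin_{U₀}(ξ) = 0` — by
nested criticality (`isCritR2_oneStepSlice`: `U₀` minimises over the one-step slice of its own `K`-average ∩ `𝔘_k(e)`), the openness of `𝔘_k(e)`
(`exists_ball_subset_regPr`), the one-step fibre = `{Ū = Ū₀}` (`descendTo_succ`), and the one-step theorem `exists_tangent_lin_eq_zero`.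
[cite: Balaban1985Variational, (127) p.297, Prop 8 p.304; Balaban1987RG1, (0.4) p.253] -/
theorem exists_tangent_lin_eq_zero_of_isCritR2 (F : T3Family) {n K : ℕ} (hnK : n ≤ K)
    {V : GaugeField (F.P n) 0 (Matrix.specialUnitaryGroup (Fin 2) ℂ)} {U₀ : GaugeField (F.P (K + 1)) 0 (Matrix.specialUnitaryGroup (Fin 2) ℂ)}
    (hcrit : IsCritR2 F n (K + 1) (hnK.trans (Nat.le_succ K)) V U₀)
    {t₀ : ℝ} (ht₀ : 0 < t₀) (hsmall : stokesConst (F.P (K + 1)) * t₀ ≤ emlWeight (F.P (K + 1)) / 1000) (hU₀ : PlaqSmall t₀ U₀)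
    (b₀ : PBond (F.P (K + 1)) 0) (hb₀ : ∀ c : PBond (F.P (K + 1)) 1, centralBond c ≠ b₀)
    (g : ℝ → Matrix.specialUnitaryGroup (Fin 2) ℂ) (hg0 : g 0 = U₀ b₀) {D₀ : Matrix (Fin 2) (Fin 2) ℂ}
    (hg : HasDerivAt (fun t : ℝ => (g t : Matrix (Fin 2) (Fin 2) ℂ)) D₀ 0) :
    ∃ ξ : PBond (F.P (K + 1)) 0 → Matrix (Fin 2) (Fin 2) ℂ,
      ξ b₀ = D₀ * star (U₀ b₀ : Matrix (Fin 2) (Fin 2) ℂ) ∧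
      (∀ b : PBond (F.P (K + 1)) 0, b ≠ b₀ → (∀ c : PBond (F.P (K + 1)) 1, centralBond c ≠ b) → ξ b = 0) ∧
      ∑ p : Plaq (F.P (K + 1)) 0, (1 / 2) * ((((((GaugeField.plaqHol U₀ p : Matrix.specialUnitaryGroup (Fin 2) ℂ) : Matrix (Fin 2) (Fin 2) ℂ)) - 1)ᴴ
          * ((ξ ⟨p.src, p.μ⟩
              + (U₀ ⟨p.src, p.μ⟩ : Matrix (Fin 2) (Fin 2) ℂ) * ξ ⟨p.src.shift p.μ, p.ν⟩ * star (U₀ ⟨p.src, p.μ⟩ : Matrix (Fin 2) (Fin 2) ℂ)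
              - ((U₀ ⟨p.src, p.μ⟩ * U₀ ⟨p.src.shift p.μ, p.ν⟩ * (U₀ ⟨p.src.shift p.ν, p.μ⟩)⁻¹ : Matrix.specialUnitaryGroup (Fin 2) ℂ) : Matrix (Fin 2) (Fin 2) ℂ)
                  * ξ ⟨p.src.shift p.ν, p.μ⟩
                  * star ((U₀ ⟨p.src, p.μ⟩ * U₀ ⟨p.src.shift p.μ, p.ν⟩ * (U₀ ⟨p.src.shift p.ν, p.μ⟩)⁻¹ : Matrix.specialUnitaryGroup (Fin 2) ℂ) : Matrix (Fin 2) (Fin 2) ℂ)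
              - ((GaugeField.plaqHol U₀ p : Matrix.specialUnitaryGroup (Fin 2) ℂ) : Matrix (Fin 2) (Fin 2) ℂ) * ξ ⟨p.src, p.ν⟩
                  * star ((GaugeField.plaqHol U₀ p : Matrix.specialUnitaryGroup (Fin 2) ℂ) : Matrix (Fin 2) (Fin 2) ℂ))
            * ((GaugeField.plaqHol U₀ p : Matrix.specialUnitaryGroup (Fin 2) ℂ) : Matrix (Fin 2) (Fin 2) ℂ))).trace).re = 0 := by
  classical
  -- nested criticality: `U₀` minimises over the one-step slice of its own `K`-average inside `𝔘_k(e)`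
  obtain ⟨e, -, hreg, -, hmin⟩ := isCritR2_oneStepSlice F hnK (Nat.le_succ K) hcrit
  -- the slice contains the germ of the one-step fibre at `U₀`
  obtain ⟨δ, hδ, hball⟩ := exists_ball_subset_regPr F n (K + 1) e U₀ hreg
  have hj : 0 + 1 ≤ (F.P (K + 1)).m + (F.P (K + 1)).K := by
    show 0 + 1 ≤ F.m + (K + 1); omega
  refine exists_tangent_lin_eq_zero hj ht₀ hsmall U₀ hU₀ hmin ⟨δ, hδ, fun U havg hdist => ⟨?_, hball U hdist⟩⟩ b₀ hb₀ g hg0 hg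
  rw [mem_fibre_iff, descendTo_succ, descendTo_succ, blockAvg_avg]
  exact congrArg _ havg

end Carrier

end Summit.QuantumFields.YangMills.Theorems.Prop8Criticality

end
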